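import Mathlib.Analysis.Real.Pi.Bounds
import Summits.Ventures.CertifiedManyBodySolver.Downfold.RectBand
import HarnessLib

/-!
# The rectangular one-band band, II: harmonic integer enclosures of the band and its derivative on a block of grid cells,
# and the mean-value CELL ENCLOSURE (orthorhombic analogue of `OneBandHarmonicEnclosure` §3 + `OneBandCellEnclosure`)

Venture CertifiedManyBodySolver, cell `pub/hubbard-downfold` (stage S1, technique B), seat hubbard-downfold-mod-4 (g25);
namespace `Summit.Ventures.CertifiedManyBodySolver.Downfold.Emery`. Everything PROVED; no number lives here. WHAT THIS IS NOT:
a statement about any material; `U = 0` one-body kinematics.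

For the rectangular band `rbBandK H` (`RectBand`) the D₂ₕ star `c_m(kx)·c_n(ky)` is enclosed on a block from the cosine /
sine ARCS of `GridCosineArcs` exactly as the tetragonal stars are (`OneBandHarmonicEnclosure`, whose integer-interval layer
`ZEncl / zmulP / zscale / zadd / arcs4 / sarcs4 / getArc / getSArc` is reused): `rectEnclZ`, `drectEnclZ`, `rbBandEnclZ`,
`rbDbandEnclZ` (scale 10²⁴), and the CELL ENCLOSURE `rbCellEnclZ` = harmonic ∩ first-order form (the `ky`-derivative is the
`kx`-derivative of the TRANSPOSED list, `hasDerivAt_rbBandK_ky`) with `rbCellEnclZ_sound` — no monotonicity premise.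

Sources: interval ranges and the mean-value form [Moore1966, §3.2, Theorem 3.1, §4.4]; one-band form [AndersenEtAl1995, §6].
-/

noncomputable section

namespace Summit.Ventures.CertifiedManyBodySolver.Downfold.Emery

open Real Set

/-! ## §1 Star, band and derivative enclosures -/

/-- Enclosure of `10⁹·c_m(θ)` from the cosine arcs: `10⁹` for `m = 0`, `2·arc` otherwise. [cite: Moore1966, Theorem 3.1] -/
def axisEnclZ (m : ℕ) (C : List (ℤ × ℤ)) : ℤ × ℤ :=
  if m = 0 then ((cosD : ℤ), (cosD : ℤ)) else zscale 2 (getArc C m)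

/-- Enclosure of `10⁹·c_m′(θ)` from the sine arcs: `0` for `m = 0`, `−2m·sinarc` otherwise. [cite: Moore1966, Theorem 3.1] -/
def dAxisEnclZ (m : ℕ) (SX : List (ℤ × ℤ)) : ℤ × ℤ :=
  if m = 0 then (0, 0) else zscale (-(2 * (m : ℤ))) (getSArc SX m)

/-- [cite: Moore1966, Theorem 3.1] -/
theorem axisEnclZ_sound {K : ℕ} {C : List (ℤ × ℤ)} {a b : ℕ} (hC : CosArcsOK K C a b) (m : ℕ) {θ : ℝ}
    (h1 : gridPt K a ≤ θ) (h2 : θ ≤ gridPt K b) :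
    ZEncl (axisEnclZ m C).1 (axisEnclZ m C).2 ((cosD : ℝ) * axisFac m θ) := by
  unfold axisEnclZ axisFac
  by_cases hm : m = 0
  · simp only [hm, if_true]; unfold ZEncl; simp
  · simp only [hm, if_false]
    exact (zscale_sound 2 (hC m θ h1 h2)).congr (by push_cast; ring)

/-- [cite: Moore1966, Theorem 3.1] -/
theorem dAxisEnclZ_sound {K : ℕ} {SX : List (ℤ × ℤ)} {a b : ℕ} (hS : SinArcsOK K SX a b) (m : ℕ) {θ : ℝ}
    (h1 : gridPt K a ≤ θ) (h2 : θ ≤ gridPt K b) :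
    ZEncl (dAxisEnclZ m SX).1 (dAxisEnclZ m SX).2 ((cosD : ℝ) * dAxisFac m θ) := by
  unfold dAxisEnclZ dAxisFac
  by_cases hm : m = 0
  · simp only [hm, if_true]; unfold ZEncl; simp
  · simp only [hm, if_false]
    exact (zscale_sound (-(2 * (m : ℤ))) (hS m θ h1 h2)).congr (by push_cast; ring)

/-- Harmonic enclosure of `10¹⁸·c_m(kx)·c_n(ky)`. [cite: Moore1966, Theorem 3.1] -/
def rectEnclZ (m n : ℕ) (CX CY : List (ℤ × ℤ)) : ℤ × ℤ := zmulP (axisEnclZ m CX) (axisEnclZ n CY)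

/-- Harmonic enclosure of `10¹⁸·∂(c_m(kx)·c_n(ky))/∂kx`. [cite: Moore1966, Theorem 3.1] -/
def drectEnclZ (m n : ℕ) (SX CY : List (ℤ × ℤ)) : ℤ × ℤ := zmulP (dAxisEnclZ m SX) (axisEnclZ n CY)

/-- [cite: Moore1966, Theorem 3.1] -/
theorem rectEnclZ_sound {K : ℕ} {CX CY : List (ℤ × ℤ)} {a0 a1 b0 b1 : ℕ} (hX : CosArcsOK K CX a0 a1)
    (hY : CosArcsOK K CY b0 b1) (m n : ℕ) {kx ky : ℝ} (hx1 : gridPt K a0 ≤ kx) (hx2 : kx ≤ gridPt K a1)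
    (hy1 : gridPt K b0 ≤ ky) (hy2 : ky ≤ gridPt K b1) :
    ZEncl (rectEnclZ m n CX CY).1 (rectEnclZ m n CX CY).2 (((cosD : ℝ) * (cosD : ℝ)) * rectStar m n kx ky) := by
  unfold rectEnclZ rectStar
  exact (zmulP_sound (axisEnclZ_sound hX m hx1 hx2) (axisEnclZ_sound hY n hy1 hy2)).congr (by ring)

/-- [cite: Moore1966, Theorem 3.1] -/
theorem drectEnclZ_sound {K : ℕ} {SX CY : List (ℤ × ℤ)} {a0 a1 b0 b1 : ℕ} (hX : SinArcsOK K SX a0 a1)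
    (hY : CosArcsOK K CY b0 b1) (m n : ℕ) {kx ky : ℝ} (hx1 : gridPt K a0 ≤ kx) (hx2 : kx ≤ gridPt K a1)
    (hy1 : gridPt K b0 ≤ ky) (hy2 : ky ≤ gridPt K b1) :
    ZEncl (drectEnclZ m n SX CY).1 (drectEnclZ m n SX CY).2 (((cosD : ℝ) * (cosD : ℝ)) * dRectStarKx m n kx ky) := by
  unfold drectEnclZ dRectStarKx
  exact (zmulP_sound (dAxisEnclZ_sound hX m hx1 hx2) (axisEnclZ_sound hY n hy1 hy2)).congr (by ring)

/-- HARMONIC BLOCK ENCLOSURE of `10²⁴·ε` (rectangular band). [cite: Moore1966, Theorem 3.1] -/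
def rbBandEnclZ (H : List (ℕ × ℕ × ℚ)) (CX CY : List (ℤ × ℤ)) : ℤ × ℤ :=
  H.foldr (fun s acc => zadd (zscale (hZ s.2.2) (rectEnclZ s.1 s.2.1 CX CY)) acc) (0, 0)

/-- HARMONIC BLOCK ENCLOSURE of `10²⁴·∂ε/∂kx` (rectangular band). [cite: Moore1966, Theorem 3.1] -/
def rbDbandEnclZ (H : List (ℕ × ℕ × ℚ)) (SX CY : List (ℤ × ℤ)) : ℤ × ℤ :=
  H.foldr (fun s acc => zadd (zscale (hZ s.2.2) (drectEnclZ s.1 s.2.1 SX CY)) acc) (0, 0)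

/-- [cite: Moore1966, Theorem 3.1] -/
theorem rbBandEnclZ_sound {K : ℕ} {CX CY : List (ℤ × ℤ)} {a0 a1 b0 b1 : ℕ} (hX : CosArcsOK K CX a0 a1)
    (hY : CosArcsOK K CY b0 b1) {H : List (ℕ × ℕ × ℚ)} (hz : hZOK H = true) {kx ky : ℝ}
    (hx1 : gridPt K a0 ≤ kx) (hx2 : kx ≤ gridPt K a1) (hy1 : gridPt K b0 ≤ ky) (hy2 : ky ≤ gridPt K b1) :
    ZEncl (rbBandEnclZ H CX CY).1 (rbBandEnclZ H CX CY).2 (bandScale * rbBandK H kx ky) := by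
  induction H with
  | nil => simp only [rbBandEnclZ, List.foldr_nil, rbBandK, List.map_nil, List.sum_nil, mul_zero]; unfold ZEncl; simp
  | cons s H ih =>
    simp only [hZOK, List.all_cons, Bool.and_eq_true, beq_iff_eq] at hz
    have ih' := ih (by simpa [hZOK] using hz.2)
    have hs := zscale_sound (hZ s.2.2) (rectEnclZ_sound hX hY s.1 s.2.1 hx1 hx2 hy1 hy2)
    have h := zadd_sound hs ih'
    simp only [rbBandEnclZ, List.foldr_cons, rbBandK, List.map_cons, List.sum_cons] at h ⊢
    refine h.congr ?_
    rw [cast_hZ hz.1]; unfold bandScale; ring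

/-- [cite: Moore1966, Theorem 3.1] -/
theorem rbDbandEnclZ_sound {K : ℕ} {SX CY : List (ℤ × ℤ)} {a0 a1 b0 b1 : ℕ} (hX : SinArcsOK K SX a0 a1)
    (hY : CosArcsOK K CY b0 b1) {H : List (ℕ × ℕ × ℚ)} (hz : hZOK H = true) {kx ky : ℝ}
    (hx1 : gridPt K a0 ≤ kx) (hx2 : kx ≤ gridPt K a1) (hy1 : gridPt K b0 ≤ ky) (hy2 : ky ≤ gridPt K b1) :
    ZEncl (rbDbandEnclZ H SX CY).1 (rbDbandEnclZ H SX CY).2 (bandScale * rbBandDx H kx ky) := by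
  induction H with
  | nil => simp only [rbDbandEnclZ, List.foldr_nil, rbBandDx, List.map_nil, List.sum_nil, mul_zero]; unfold ZEncl; simp
  | cons s H ih =>
    simp only [hZOK, List.all_cons, Bool.and_eq_true, beq_iff_eq] at hz
    have ih' := ih (by simpa [hZOK] using hz.2)
    have hs := zscale_sound (hZ s.2.2) (drectEnclZ_sound hX hY s.1 s.2.1 hx1 hx2 hy1 hy2)
    have h := zadd_sound hs ih'
    simp only [rbDbandEnclZ, List.foldr_cons, rbBandDx, List.map_cons, List.sum_cons] at h ⊢
    refine h.congr ?_
    rw [cast_hZ hz.1]; unfold bandScale; ring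

/-- `hZOK` is transpose-invariant. [folklore] -/
theorem hZOK_rbT {H : List (ℕ × ℕ × ℚ)} (hz : hZOK H = true) : hZOK (rbT H) = true := by
  induction H with
  | nil => rfl
  | cons s H ih =>
    simp only [hZOK, rbT, List.all_cons, List.map_cons, Bool.and_eq_true] at hz ⊢
    exact ⟨hz.1, by simpa [hZOK, rbT] using ih (by simpa [hZOK] using hz.2)⟩

/-! ## §2 The mean-value cell enclosure -/

/-- **THE CELL ENCLOSURE** of `10²⁴·10⁶·K·ε` (rectangular band) on the block `[k_{a0}, k_{a1}] × [k_{b0}, k_{b1}]`.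
[cite: Moore1966, Theorem 3.1, §4.4] -/
def rbCellEnclZ (K : ℕ) (cl ch : ℕ → ℤ) (H : List (ℕ × ℕ × ℚ)) (a0 a1 b0 b1 : ℕ) : ℤ × ℤ :=
  let CX := arcs4 K cl ch a0 a1
  let CY := arcs4 K cl ch b0 b1
  let CX0 := arcs4 K cl ch a0 a0
  let CY0 := arcs4 K cl ch b0 b0
  let SX := sarcs4 K cl ch a0 a1
  let SY := sarcs4 K cl ch b0 b1
  let hb := rbBandEnclZ H CX CY
  let p := rbBandEnclZ H CX0 CY0
  let dx := rbDbandEnclZ H SX CY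
  let dy := rbDbandEnclZ (rbT H) SY CX0
  let M : ℤ := (hH : ℤ) * K
  (max (hb.1 * M) (p.1 * M + incLo dx.1 (a1 - a0) + incLo dy.1 (b1 - b0)),
   min (hb.2 * M) (p.2 * M + incHi dx.2 (a1 - a0) + incHi dy.2 (b1 - b0)))

/-- **SOUNDNESS OF THE CELL ENCLOSURE** (rectangular band; no monotonicity premise). [cite: Moore1966, Theorem 3.1, §4.4] -/
theorem rbCellEnclZ_sound {K : ℕ} (hK : 0 < K) (hev : K % 2 = 0) {cl ch : ℕ → ℤ} (hT : CosEnclZ K cl ch)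
    {H : List (ℕ × ℕ × ℚ)} (hz : hZOK H = true) {a0 a1 b0 b1 : ℕ} (ha : a0 ≤ a1) (hb : b0 ≤ b1) {kx ky : ℝ}
    (hx1 : gridPt K a0 ≤ kx) (hx2 : kx ≤ gridPt K a1) (hy1 : gridPt K b0 ≤ ky) (hy2 : ky ≤ gridPt K b1) :
    ZEncl (rbCellEnclZ K cl ch H a0 a1 b0 b1).1 (rbCellEnclZ K cl ch H a0 a1 b0 b1).2 (cellScale K * rbBandK H kx ky) := by
  have hKr : (0 : ℝ) < K := by exact_mod_cast hK
  have hM : (0 : ℝ) ≤ (hH : ℝ) * K := by positivity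
  have hX := arcs4_sound hK hT a0 a1
  have hY := arcs4_sound hK hT b0 b1
  have hX0 := arcs4_sound hK hT a0 a0
  have hY0 := arcs4_sound hK hT b0 b0
  have hSX := sarcs4_sound hK hev hT a0 a1
  have hSY := sarcs4_sound hK hev hT b0 b1
  have hHT := hZOK_rbT hz
  have hblk := rbBandEnclZ_sound hX hY hz hx1 hx2 hy1 hy2
  have hpt := rbBandEnclZ_sound hX0 hY0 hz (le_refl (gridPt K a0)) le_rfl (le_refl (gridPt K b0)) le_rfl
  have hincx : ZEncl (incLo (rbDbandEnclZ H (sarcs4 K cl ch a0 a1) (arcs4 K cl ch b0 b1)).1 (a1 - a0))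
      (incHi (rbDbandEnclZ H (sarcs4 K cl ch a0 a1) (arcs4 K cl ch b0 b1)).2 (a1 - a0))
      ((hH : ℝ) * K * (bandScale * (rbBandK H kx ky - rbBandK H (gridPt K a0) ky))) := by
    rcases eq_or_lt_of_le hx1 with heq | hlt
    · rw [← heq, sub_self, mul_zero, mul_zero]
      unfold ZEncl incLo incHi; push_cast; exact ⟨min_le_left _ _, le_max_left _ _⟩
    · obtain ⟨ξ, hξ, hslope⟩ := exists_hasDerivAt_eq_slope (fun x => rbBandK H x ky) (fun x => rbBandDx H x ky)
        hlt (continuous_rbBandK_kx H ky).continuousOn (fun x _ => hasDerivAt_rbBandK_kx H x ky)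
      have hne : kx - gridPt K a0 ≠ 0 := sub_ne_zero.2 hlt.ne'
      have hdiff : rbBandK H kx ky - rbBandK H (gridPt K a0) ky = rbBandDx H ξ ky * (kx - gridPt K a0) := by
        rw [hslope]; field_simp
      have hd := rbDbandEnclZ_sound hSX hY hz hξ.1.le (hξ.2.le.trans hx2) hy1 hy2
      have hΔ : kx - gridPt K a0 ≤ ((a1 - a0 : ℕ) : ℝ) * π / K := by rw [← gridPt_sub ha]; linarith
      have := inc_sound hK hd (sub_nonneg.2 hx1) hΔ
      refine this.congr ?_
      rw [hdiff]; ring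
  have hincy : ZEncl (incLo (rbDbandEnclZ (rbT H) (sarcs4 K cl ch b0 b1) (arcs4 K cl ch a0 a0)).1 (b1 - b0))
      (incHi (rbDbandEnclZ (rbT H) (sarcs4 K cl ch b0 b1) (arcs4 K cl ch a0 a0)).2 (b1 - b0))
      ((hH : ℝ) * K * (bandScale * (rbBandK H (gridPt K a0) ky - rbBandK H (gridPt K a0) (gridPt K b0)))) := by
    rcases eq_or_lt_of_le hy1 with heq | hlt
    · rw [← heq, sub_self, mul_zero, mul_zero]
      unfold ZEncl incLo incHi; push_cast; exact ⟨min_le_left _ _, le_max_left _ _⟩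
    · obtain ⟨η, hη, hslope⟩ := exists_hasDerivAt_eq_slope (fun y => rbBandK H (gridPt K a0) y)
        (fun y => rbBandDx (rbT H) y (gridPt K a0)) hlt (continuous_rbBandK_ky H (gridPt K a0)).continuousOn
        (fun y _ => hasDerivAt_rbBandK_ky H (gridPt K a0) y)
      have hne : ky - gridPt K b0 ≠ 0 := sub_ne_zero.2 hlt.ne'
      have hdiff : rbBandK H (gridPt K a0) ky - rbBandK H (gridPt K a0) (gridPt K b0) =
          rbBandDx (rbT H) η (gridPt K a0) * (ky - gridPt K b0) := by
        rw [hslope]; field_simp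
      have hd := rbDbandEnclZ_sound hSY hX0 hHT hη.1.le (hη.2.le.trans hy2) (le_refl (gridPt K a0)) le_rfl
      have hΔ : ky - gridPt K b0 ≤ ((b1 - b0 : ℕ) : ℝ) * π / K := by rw [← gridPt_sub hb]; linarith
      have := inc_sound hK hd (sub_nonneg.2 hy1) hΔ
      refine this.congr ?_
      rw [hdiff]; ring
  obtain ⟨hb1, hb2⟩ := hblk
  obtain ⟨hp1, hp2⟩ := hpt
  obtain ⟨hx1', hx2'⟩ := hincx
  obtain ⟨hy1', hy2'⟩ := hincy
  have hdecomp : cellScale K * rbBandK H kx ky =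
      bandScale * rbBandK H (gridPt K a0) (gridPt K b0) * ((hH : ℝ) * K) +
      (hH : ℝ) * K * (bandScale * (rbBandK H kx ky - rbBandK H (gridPt K a0) ky)) +
      (hH : ℝ) * K * (bandScale * (rbBandK H (gridPt K a0) ky - rbBandK H (gridPt K a0) (gridPt K b0))) := by
    unfold cellScale; ring
  have hharm : cellScale K * rbBandK H kx ky = bandScale * rbBandK H kx ky * ((hH : ℝ) * K) := by
    unfold cellScale; ring
  unfold rbCellEnclZ ZEncl
  simp only
  push_cast
  constructor
  · refine max_le ?_ ?_
    · rw [hharm]; exact mul_le_mul_of_nonneg_right hb1 hM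
    · rw [hdecomp]; nlinarith [mul_le_mul_of_nonneg_right hp1 hM]
  · refine le_min ?_ ?_
    · rw [hharm]; exact mul_le_mul_of_nonneg_right hb2 hM
    · rw [hdecomp]; nlinarith [mul_le_mul_of_nonneg_right hp2 hM]

/-- Harmonic-only block enclosure at the cell scale (rectangular band). [cite: Moore1966, Theorem 3.1] -/
def rbHarmBlockZ (K : ℕ) (cl ch : ℕ → ℤ) (H : List (ℕ × ℕ × ℚ)) (a0 a1 b0 b1 : ℕ) : ℤ × ℤ :=
  let hb := rbBandEnclZ H (arcs4 K cl ch a0 a1) (arcs4 K cl ch b0 b1)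
  (hb.1 * ((hH : ℤ) * K), hb.2 * ((hH : ℤ) * K))

/-- The leaf enclosure: harmonic-only or full cell enclosure (rectangular band). [cite: Moore1966, Theorem 3.1, §4.4] -/
def rbBlockEnclZ (K : ℕ) (cl ch : ℕ → ℤ) (H : List (ℕ × ℕ × ℚ)) (mv : Bool) (a0 a1 b0 b1 : ℕ) : ℤ × ℤ :=
  if mv then rbCellEnclZ K cl ch H a0 a1 b0 b1 else rbHarmBlockZ K cl ch H a0 a1 b0 b1

/-- **Soundness of the leaf enclosure** (rectangular band). [cite: Moore1966, Theorem 3.1, §4.4] -/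
theorem rbBlockEnclZ_sound {K : ℕ} (hK : 0 < K) (hev : K % 2 = 0) {cl ch : ℕ → ℤ} (hT : CosEnclZ K cl ch)
    {H : List (ℕ × ℕ × ℚ)} (hz : hZOK H = true) (mv : Bool) {a0 a1 b0 b1 : ℕ} (ha : a0 ≤ a1) (hb : b0 ≤ b1)
    {kx ky : ℝ} (hx1 : gridPt K a0 ≤ kx) (hx2 : kx ≤ gridPt K a1) (hy1 : gridPt K b0 ≤ ky) (hy2 : ky ≤ gridPt K b1) :
    ZEncl (rbBlockEnclZ K cl ch H mv a0 a1 b0 b1).1 (rbBlockEnclZ K cl ch H mv a0 a1 b0 b1).2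
      (cellScale K * rbBandK H kx ky) := by
  unfold rbBlockEnclZ
  cases mv
  · simp only [Bool.false_eq_true, if_false]
    have h := rbBandEnclZ_sound (arcs4_sound hK hT a0 a1) (arcs4_sound hK hT b0 b1) hz hx1 hx2 hy1 hy2
    obtain ⟨h1, h2⟩ := h
    have hM : (0 : ℝ) ≤ (hH : ℝ) * K := by positivity
    unfold rbHarmBlockZ ZEncl cellScale
    push_cast
    constructor
    · calc _ ≤ bandScale * rbBandK H kx ky * ((hH : ℝ) * K) := mul_le_mul_of_nonneg_right h1 hM
        _ = _ := by ring
    · calc bandScale * ((hH : ℝ) * K) * rbBandK H kx ky = bandScale * rbBandK H kx ky * ((hH : ℝ) * K) := by ring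
        _ ≤ _ := mul_le_mul_of_nonneg_right h2 hM
  · simp only [if_true]
    exact rbCellEnclZ_sound hK hev hT hz ha hb hx1 hx2 hy1 hy2

end Summit.Ventures.CertifiedManyBodySolver.Downfold.Emery
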